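import Mathlib
import HarnessLib
import Summits.HubbardSuperconductivity.HubbardSuperconductivity.Theorems.KLProgrammeKLRegimeSliceSymbolTorusNbhd
import Summits.HubbardSuperconductivity.HubbardSuperconductivity.Theorems.KLProgrammeKLRegimeSliceSymbolTorusThird

/-!
# Route `KLProgramme` — engine support (route (L2), weighted lines): the propagator's differences up to ORDER THREE on the THREE-STEP
# neighbourhood of a multiplier support, with the constant tangential datum

Cell `gate-hubbard-kl`, seat hubbard-kl-k3c3-p2 (g8), for the ENGINE child stmt-HubbardSuperconductivity-20437 (`stub_engine_step_norms`, WEIGHTED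
lines / (E4)ₙ; located risk «(b)-Wt@j≥1»).  The order-three twin of k3c2-p3's `KLProgrammeKLRegimeSliceSymbolTorusNbhd`: the order-three discrete
Leibniz rule `…SectorSliceCharSumMoment.norm_fwdDiff_iter_three_smul_mul_le_of_support` needs the propagator's differences of orders `0 … 3` along
`(0, r̄)` only at points `q` with `M(q + j•(0,r̄)) ≠ 0` for some `j ≤ 3`; the anisotropic input there is the tangential datum `|De_K(c(q₂))·w| ≤ τ`
certified ON the support, moved to the three-step neighbourhood at the cost `3K₂‖w‖²` (`abs_fderiv_frameLevel_centred_le_of_shift`):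

* `abs_fderiv_frameLevel_le_of_near_support_three` — `|De_K(c(q₂))·w| ≤ τ + 3K₂‖w‖²` on the three-step neighbourhood;
* `norm_fwdDiff_space_sliceSymbolTorus_le_of_near_support_three` — `‖Δ Ψ(q)‖ ≤ K₁^Ψ(τ + 4K₂‖w‖²)`;
* `norm_fwdDiff_two_space_sliceSymbolTorus_le_of_near_support_three` — `‖Δ² Ψ(q)‖ ≤ K₂^Ψ(τ + 5K₂‖w‖²)² + K₁^Ψ K₂‖w‖²`;
* **`norm_fwdDiff_three_space_sliceSymbolTorus_le_of_near_support`** — `‖Δ³ Ψ(q)‖ ≤ K₃^Ψ(τ + 6K₂‖w‖²)³ + 3K₂^Ψ(τ + 6K₂‖w‖²)K₂‖w‖² + K₁^Ψ K₃‖w‖³`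

(`K₁^Ψ = (16B₁+16)c/Λ²`, `K₂^Ψ = (32B₂+144B₁+128)c/Λ³`, `K₃^Ψ = (64B₃+480B₂+1728B₁+1536)c/Λ⁴`; band `‖D²e_K‖ ≤ K₂`, `‖D³e_K‖ ≤ K₃`).
Everything is proved; no definitions, no named facts. [folklore]

References: G. Benfatto, A. Giuliani, V. Mastropietro, Ann. Henri Poincaré 7 (2006) 809–898, Lemma 2.2 (2.52)–(2.55), (2.36aa) and footnote ¹.
-/

noncomputable section

namespace Summit.HubbardSuperconductivity.HubbardSuperconductivity.Theorems.TorusFourierL2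

set_option linter.dupNamespace false -- summit = problem name (single-conjunct summit), D-0017

open Set Complex Finset Literature.MathematicalPhysics.QuantumLattice Literature.Probability.LatticeModels
open Summit.HubbardSuperconductivity.HubbardSuperconductivity.Theorems.DispersionFlow
open scoped Real

section Nbhd

variable {L M : ℕ} [NeZero L] [NeZero M] {c Λ Λ' β μ : ℝ} {K : TrigPolyC4v}

omit [NeZero M] in
/-- **The tangential datum on the three-step neighbourhood**: if `|De_K(c(q'₂))·w| ≤ τ` wherever `M q' ≠ 0`, then
`|De_K(c(q₂))·w| ≤ τ + 3K₂‖w‖²` at every `q` with `M(q + j•(0,r̄)) ≠ 0` for some `j ≤ 3`. [folklore] -/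
theorem abs_fderiv_frameLevel_le_of_near_support_three {K₂ : ℝ} (hK₂ : ∀ p, ‖iteratedFDeriv ℝ 2 (frameLevel μ K) p‖ ≤ K₂)
    (Mf : TorusSite 1 (2 * M) × TorusSite 2 L → ℂ) (r : Fin 2 → ℤ) {τ : ℝ}
    (hτ : ∀ q', Mf q' ≠ 0 → |fderiv ℝ (frameLevel μ K) (WithLp.toLp 2 (torusCentredMomentum L q'.2))
      (WithLp.toLp 2 (fun i => 2 * π / L * (r i : ℝ)))| ≤ τ)
    (q : TorusSite 1 (2 * M) × TorusSite 2 L)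
    (hq : ∃ j : ℕ, j ≤ 3 ∧ Mf (q + j • ((0 : TorusSite 1 (2 * M)), (fun i => ((r i : ℤ) : ZMod L)))) ≠ 0) :
    |fderiv ℝ (frameLevel μ K) (WithLp.toLp 2 (torusCentredMomentum L q.2)) (WithLp.toLp 2 (fun i => 2 * π / L * (r i : ℝ)))| ≤
      τ + 3 * (K₂ * ‖(WithLp.toLp 2 (fun i => 2 * π / L * (r i : ℝ)) : EuclideanSpace ℝ (Fin 2))‖ ^ 2) := by
  obtain ⟨j, hj, hne⟩ := hq
  have hK0 : 0 ≤ K₂ := le_trans (norm_nonneg _) (hK₂ 0)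
  have h1 := abs_fderiv_frameLevel_centred_le_of_shift μ K hK₂ q.2 r j
  have h2 := hτ _ hne
  have e : (q + j • ((0 : TorusSite 1 (2 * M)), (fun i => ((r i : ℤ) : ZMod L)))).2 = q.2 + j • fun i => ((r i : ℤ) : ZMod L) := by
    simp [Prod.smul_mk]
  rw [e] at h2
  have hj' : (j : ℝ) * (K₂ * ‖(WithLp.toLp 2 (fun i => 2 * π / L * (r i : ℝ)) : EuclideanSpace ℝ (Fin 2))‖ ^ 2) ≤
      3 * (K₂ * ‖(WithLp.toLp 2 (fun i => 2 * π / L * (r i : ℝ)) : EuclideanSpace ℝ (Fin 2))‖ ^ 2) := by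
    have : (j : ℝ) ≤ 3 := by exact_mod_cast hj
    exact mul_le_mul_of_nonneg_right this (by positivity)
  linarith

/-- **First spatial difference on the three-step neighbourhood**: `‖Δ_{(0,r̄)} Ψ (q)‖ ≤ (16B₁+16)(c/Λ²)(τ + 4K₂‖w‖²)`.
[cite: BenfattoGiulianiMastropietro2006, Lemma 2.2 (2.36aa)] -/
theorem norm_fwdDiff_space_sliceSymbolTorus_le_of_near_support_three {K₂ : ℝ} (hK₂ : ∀ p, ‖iteratedFDeriv ℝ 2 (frameLevel μ K) p‖ ≤ K₂)
    (hΛ : 0 < Λ) (hΛΛ' : Λ ≤ Λ') (hc : 0 ≤ c) {B₁ : ℝ} (hB₁ : ∀ x, |deriv salmhoferCutoff x| ≤ B₁)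
    (Mf : TorusSite 1 (2 * M) × TorusSite 2 L → ℂ) (r : Fin 2 → ℤ) {τ : ℝ}
    (hτ : ∀ q', Mf q' ≠ 0 → |fderiv ℝ (frameLevel μ K) (WithLp.toLp 2 (torusCentredMomentum L q'.2))
      (WithLp.toLp 2 (fun i => 2 * π / L * (r i : ℝ)))| ≤ τ)
    (q : TorusSite 1 (2 * M) × TorusSite 2 L)
    (hq : ∃ j : ℕ, j ≤ 3 ∧ Mf (q + j • ((0 : TorusSite 1 (2 * M)), (fun i => ((r i : ℤ) : ZMod L)))) ≠ 0) :
    ‖fwdDiff ((0 : TorusSite 1 (2 * M)), (fun i => ((r i : ℤ) : ZMod L)))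
        (fun q : TorusSite 1 (2 * M) × TorusSite 2 L =>
          sliceSymbolFnXi c 0 Λ Λ' (matsubaraFreq β M ⟨(q.1 0).val, ZMod.val_lt (q.1 0)⟩) (nambuXiCT L μ K q.2)) q‖ ≤
      (16 * B₁ + 16) * c / Λ ^ 2 *
        (τ + 4 * (K₂ * ‖(WithLp.toLp 2 (fun i => 2 * π / L * (r i : ℝ)) : EuclideanSpace ℝ (Fin 2))‖ ^ 2)) := by
  have hB10 : 0 ≤ B₁ := (abs_nonneg _).trans (hB₁ 0)
  have h := norm_fwdDiff_space_sliceSymbolTorus_le (c := c) (β := β) (μ := μ) (K := K) hK₂ hΛ hΛΛ' hc hB₁ r q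
  have hτ' := abs_fderiv_frameLevel_le_of_near_support_three hK₂ Mf r hτ q hq
  refine h.trans (mul_le_mul_of_nonneg_left ?_ (by positivity))
  linarith

/-- **Second spatial difference on the three-step neighbourhood**: `‖(Δ_{(0,r̄)})² Ψ (q)‖ ≤ (32B₂+144B₁+128)(c/Λ³)(τ + 5K₂‖w‖²)² + (16B₁+16)(c/Λ²)K₂‖w‖²`.
[cite: BenfattoGiulianiMastropietro2006, Lemma 2.2 (2.36aa)] -/
theorem norm_fwdDiff_two_space_sliceSymbolTorus_le_of_near_support_three {K₂ : ℝ} (hK₂ : ∀ p, ‖iteratedFDeriv ℝ 2 (frameLevel μ K) p‖ ≤ K₂)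
    (hΛ : 0 < Λ) (hΛΛ' : Λ ≤ Λ') (hc : 0 ≤ c) {B₁ B₂ : ℝ} (hB₁ : ∀ x, |deriv salmhoferCutoff x| ≤ B₁)
    (hB₂ : ∀ x, |deriv (deriv salmhoferCutoff) x| ≤ B₂) (Mf : TorusSite 1 (2 * M) × TorusSite 2 L → ℂ) (r : Fin 2 → ℤ) {τ : ℝ}
    (hτ : ∀ q', Mf q' ≠ 0 → |fderiv ℝ (frameLevel μ K) (WithLp.toLp 2 (torusCentredMomentum L q'.2))
      (WithLp.toLp 2 (fun i => 2 * π / L * (r i : ℝ)))| ≤ τ)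
    (q : TorusSite 1 (2 * M) × TorusSite 2 L)
    (hq : ∃ j : ℕ, j ≤ 3 ∧ Mf (q + j • ((0 : TorusSite 1 (2 * M)), (fun i => ((r i : ℤ) : ZMod L)))) ≠ 0) :
    ‖((fwdDiff ((0 : TorusSite 1 (2 * M)), (fun i => ((r i : ℤ) : ZMod L))))^[2]
        (fun q : TorusSite 1 (2 * M) × TorusSite 2 L =>
          sliceSymbolFnXi c 0 Λ Λ' (matsubaraFreq β M ⟨(q.1 0).val, ZMod.val_lt (q.1 0)⟩) (nambuXiCT L μ K q.2))) q‖ ≤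
      (32 * B₂ + 144 * B₁ + 128) * c / Λ ^ 3 *
          (τ + 5 * (K₂ * ‖(WithLp.toLp 2 (fun i => 2 * π / L * (r i : ℝ)) : EuclideanSpace ℝ (Fin 2))‖ ^ 2)) ^ 2 +
        (16 * B₁ + 16) * c / Λ ^ 2 * (K₂ * ‖(WithLp.toLp 2 (fun i => 2 * π / L * (r i : ℝ)) : EuclideanSpace ℝ (Fin 2))‖ ^ 2) := by
  have hB10 : 0 ≤ B₁ := (abs_nonneg _).trans (hB₁ 0)
  have hB20 : 0 ≤ B₂ := (abs_nonneg _).trans (hB₂ 0)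
  have hK0 : 0 ≤ K₂ := le_trans (norm_nonneg _) (hK₂ 0)
  have h := norm_fwdDiff_two_space_sliceSymbolTorus_le (c := c) (β := β) (μ := μ) (K := K) hK₂ hΛ hΛΛ' hc hB₁ hB₂ r q
  have hτ' := abs_fderiv_frameLevel_le_of_near_support_three hK₂ Mf r hτ q hq
  refine h.trans (add_le_add (mul_le_mul_of_nonneg_left ?_ (by positivity)) le_rfl)
  have hsum : |fderiv ℝ (frameLevel μ K) (WithLp.toLp 2 (torusCentredMomentum L q.2)) (WithLp.toLp 2 (fun i => 2 * π / L * (r i : ℝ)))| +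
      2 * (K₂ * ‖(WithLp.toLp 2 (fun i => 2 * π / L * (r i : ℝ)) : EuclideanSpace ℝ (Fin 2))‖ ^ 2) ≤
      τ + 5 * (K₂ * ‖(WithLp.toLp 2 (fun i => 2 * π / L * (r i : ℝ)) : EuclideanSpace ℝ (Fin 2))‖ ^ 2) := by linarith
  exact pow_le_pow_left₀ (by positivity) hsum 2

/-- **Third spatial difference of the slice profile on the three-step neighbourhood of a support** with the constant tangential datum
(`‖D²e_K‖ ≤ K₂`, `‖D³e_K‖ ≤ K₃`):
`‖(Δ_{(0,r̄)})³ Ψ (q)‖ ≤ K₃^Ψ(τ + 6K₂‖w‖²)³ + 3K₂^Ψ(τ + 6K₂‖w‖²)(K₂‖w‖²) + K₁^Ψ(K₃‖w‖³)`. [cite: BenfattoGiulianiMastropietro2006, Lemma 2.2 (2.52)–(2.55)] -/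
theorem norm_fwdDiff_three_space_sliceSymbolTorus_le_of_near_support {K₂ K₃ : ℝ}
    (hK₂ : ∀ p, ‖iteratedFDeriv ℝ 2 (frameLevel μ K) p‖ ≤ K₂) (hK₃ : ∀ p, ‖iteratedFDeriv ℝ 3 (frameLevel μ K) p‖ ≤ K₃)
    (hΛ : 0 < Λ) (hΛΛ' : Λ ≤ Λ') (hc : 0 ≤ c) {B₁ B₂ B₃ : ℝ} (hB₁ : ∀ x, |deriv salmhoferCutoff x| ≤ B₁)
    (hB₂ : ∀ x, |deriv (deriv salmhoferCutoff) x| ≤ B₂) (hB₃ : ∀ x, |deriv (deriv (deriv salmhoferCutoff)) x| ≤ B₃)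
    (Mf : TorusSite 1 (2 * M) × TorusSite 2 L → ℂ) (r : Fin 2 → ℤ) {τ : ℝ}
    (hτ : ∀ q', Mf q' ≠ 0 → |fderiv ℝ (frameLevel μ K) (WithLp.toLp 2 (torusCentredMomentum L q'.2))
      (WithLp.toLp 2 (fun i => 2 * π / L * (r i : ℝ)))| ≤ τ)
    (q : TorusSite 1 (2 * M) × TorusSite 2 L)
    (hq : ∃ j : ℕ, j ≤ 3 ∧ Mf (q + j • ((0 : TorusSite 1 (2 * M)), (fun i => ((r i : ℤ) : ZMod L)))) ≠ 0) :
    ‖((fwdDiff ((0 : TorusSite 1 (2 * M)), (fun i => ((r i : ℤ) : ZMod L))))^[3]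
        (fun q : TorusSite 1 (2 * M) × TorusSite 2 L =>
          sliceSymbolFnXi c 0 Λ Λ' (matsubaraFreq β M ⟨(q.1 0).val, ZMod.val_lt (q.1 0)⟩) (nambuXiCT L μ K q.2))) q‖ ≤
      (64 * B₃ + 480 * B₂ + 1728 * B₁ + 1536) * c / Λ ^ 4 *
          (τ + 6 * (K₂ * ‖(WithLp.toLp 2 (fun i => 2 * π / L * (r i : ℝ)) : EuclideanSpace ℝ (Fin 2))‖ ^ 2)) ^ 3 +
        3 * ((32 * B₂ + 144 * B₁ + 128) * c / Λ ^ 3 *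
          (τ + 6 * (K₂ * ‖(WithLp.toLp 2 (fun i => 2 * π / L * (r i : ℝ)) : EuclideanSpace ℝ (Fin 2))‖ ^ 2)) *
          (K₂ * ‖(WithLp.toLp 2 (fun i => 2 * π / L * (r i : ℝ)) : EuclideanSpace ℝ (Fin 2))‖ ^ 2)) +
        (16 * B₁ + 16) * c / Λ ^ 2 * (K₃ * ‖(WithLp.toLp 2 (fun i => 2 * π / L * (r i : ℝ)) : EuclideanSpace ℝ (Fin 2))‖ ^ 3) := by
  have hK0 : 0 ≤ K₂ := le_trans (norm_nonneg _) (hK₂ 0)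
  have hτ' := abs_fderiv_frameLevel_le_of_near_support_three hK₂ Mf r hτ q hq
  have hτ'' : |fderiv ℝ (frameLevel μ K) (WithLp.toLp 2 (torusCentredMomentum L q.2)) (WithLp.toLp 2 (fun i => 2 * π / L * (r i : ℝ)))| ≤
      τ + 3 * (K₂ * ‖(WithLp.toLp 2 (fun i => 2 * π / L * (r i : ℝ)) : EuclideanSpace ℝ (Fin 2))‖ ^ 2) := hτ'
  have h := norm_fwdDiff_three_space_sliceSymbolTorus_le_of_le (c := c) (β := β) (μ := μ) (K := K) hK₂ hK₃ hΛ hΛΛ' hc hB₁ hB₂ hB₃ r q hτ''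
  have e : τ + 3 * (K₂ * ‖(WithLp.toLp 2 (fun i => 2 * π / L * (r i : ℝ)) : EuclideanSpace ℝ (Fin 2))‖ ^ 2) +
      3 * (K₂ * ‖(WithLp.toLp 2 (fun i => 2 * π / L * (r i : ℝ)) : EuclideanSpace ℝ (Fin 2))‖ ^ 2) =
      τ + 6 * (K₂ * ‖(WithLp.toLp 2 (fun i => 2 * π / L * (r i : ℝ)) : EuclideanSpace ℝ (Fin 2))‖ ^ 2) := by ring
  rw [e] at h
  exact h

end Nbhd

end Summit.HubbardSuperconductivity.HubbardSuperconductivity.Theorems.TorusFourierL2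

end
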